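import Literature.NumberTheory.LFunctions.Zhang2022.Section8Lemma82Steps
import Literature.NumberTheory.LFunctions.Zhang2022.Section8PerronSteps
import Literature.NumberTheory.LFunctions.Zhang2022.TypedSection08B
import HarnessLib

/-!
# Zhang (2022) §8: the circle-integral steps in the proof of Lemma 8.4, kernel-checked

Cell `siegel-zhang` (D-0069 width campaign), layer L2; companion of `Section8Lemma82Steps`.
DAG nodes of Y. Zhang, *Discrete mean estimates and the Landau–Siegel zero*, arXiv:2211.02515v1
[Zhang2022LandauSiegel] — **an unrefereed manuscript under adjudication; this file proves
displayed proof steps / deductions and asserts nothing about its Theorems 1–2 or about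
Landau–Siegel zeros.**

* `Z22:§8.u038` [Z22 p.46, tex L2410] (proof of Lemma 8.4): "for `|s| = 5α`,
  `L(1+s+β_{j+1},χ)L(1+s+β_{j+2},χ)/L(1+s,χ) = L′(1,χ)(s+β_{j+1})(s+β_{j+2})/s + O(𝓛⁻¹⁵)`" —
  `step8u038`, DISCHARGED from Lemmas 5.7 and 5.8 of the tree (`Skeleton.lemma57_holds`,
  `Skeleton.lemma58_holds`); the printed attribution is "By Lemma 5.5 and 5.6" (recorded, not
  judged). The algebra is isolated in `norm_ratio_sub_le`.
  The statement is L2-t6's `Typed.S8B.LQuotientOnCircle c′` (`TypedSection08B`, p412401) unfolded,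
  for every `j` (the typed node quantifies `j ∈ {1,2,3}`); the one-line bridge is appended once
  that statement file is in the tree. The closing inference of `Z22:Lem8.4.pf` ("direct
  calculation", tree `circleIntegral_lemma84`) is L2-t6's `lemma84_of`, not repeated here.

No `Prop` is declared here. The last section bridges to the typed nodes of record
(`TypedSection08B`): `sum82EqLineIntegral_holds` (u027), `lQuotientOnCircle_holds` (u038),
`sum82CircleMainTerm_of_viaCircle` (u030 line 1 ⇒ line 2) and `lemma82_of_viaCircle`
(Lemma 8.2 ⇐ the contour-shift display alone).

Not touched (named residual CLAIMS): the contour shift "moved in the same way as in the proof of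
Lemma 8.2" and the combination with Lemma 8.3 inside `u039` (whose printed uniform `O(𝓛⁻⁶)`
absorbs a factor `sup_{|s|=5α}|𝔲_j(d,r;1+s)| ≍ |Π(d,r)|`), Lemma 8.3 / Appendix A, and the
absolute convergence behind (8.9).
-/

noncomputable section

open Complex Real Metric

namespace Literature.NumberTheory.LFunctions.Zhang2022.Section8Lemma84Steps

open Literature.NumberTheory.LFunctions.Zhang2022.Skeleton
open Literature.NumberTheory.LFunctions.Zhang2022.Section8Lemma82Steps

/-! ### `Z22:§8.u038`: the ratio `L(1+s+β_{j+1})L(1+s+β_{j+2})/L(1+s)` on `|s| = 5α` -/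

/-- The algebra of `u038`: if `L₁ = au + E₁`, `L₂ = av + E₂`, `L₀ = as + E₀` with `|E_i| ≤ ε`,
`|s| = 5α`, `|u|, |v| ≤ 17α/2`, `a ≠ 0` and `ε ≤ (5/2)|a|α`, then
`|L₁L₂/L₀ − auv/s| ≤ 14ε`. [cite: Zhang2022LandauSiegel, §8 Lemma 8.4 (proof), p.46] -/
theorem norm_ratio_sub_le {a s u v L₀ L₁ L₂ : ℂ} {α ε : ℝ} (hα : 0 < α) (hε : 0 ≤ ε)
    (ha : 0 < ‖a‖) (hs : ‖s‖ = 5 * α) (hu : ‖u‖ ≤ 17 / 2 * α) (hv : ‖v‖ ≤ 17 / 2 * α)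
    (h1 : ‖L₁ - a * u‖ ≤ ε) (h2 : ‖L₂ - a * v‖ ≤ ε) (h0 : ‖L₀ - a * s‖ ≤ ε)
    (hεa : ε ≤ 5 / 2 * ‖a‖ * α) :
    ‖L₁ * L₂ / L₀ - a * u * v / s‖ ≤ 14 * ε := by
  set E₁ := L₁ - a * u with hE₁
  set E₂ := L₂ - a * v with hE₂
  set E₀ := L₀ - a * s with hE₀
  have hs0 : s ≠ 0 := by
    intro h; rw [h, norm_zero] at hs; linarith
  -- lower bound for `|L₀|`
  have hL₀ : 5 / 2 * ‖a‖ * α ≤ ‖L₀‖ := by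
    have : ‖a * s‖ ≤ ‖L₀‖ + ‖E₀‖ := by
      have e : a * s = L₀ - E₀ := by rw [hE₀]; ring
      rw [e]; exact norm_sub_le _ _
    rw [norm_mul, hs] at this
    have hE₀' : ‖E₀‖ ≤ 5 / 2 * ‖a‖ * α := h0.trans hεa
    linarith
  have hL₀pos : 0 < ‖L₀‖ := lt_of_lt_of_le (by positivity) hL₀
  have hL₀0 : L₀ ≠ 0 := norm_pos_iff.mp hL₀pos
  rw [div_sub_div _ _ hL₀0 hs0]
  have hnum : L₁ * L₂ * s - L₀ * (a * u * v) =
      s * (a * u * E₂ + a * v * E₁ + E₁ * E₂) - a * u * v * E₀ := by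
    rw [hE₁, hE₂, hE₀]; ring
  rw [hnum, norm_div, norm_mul, div_le_iff₀ (by positivity)]
  -- bound the numerator
  have hn1 : ‖s * (a * u * E₂ + a * v * E₁ + E₁ * E₂)‖ ≤
      5 * α * (‖a‖ * (17 / 2 * α) * ε + ‖a‖ * (17 / 2 * α) * ε + ε * ε) := by
    rw [norm_mul, hs]
    refine mul_le_mul_of_nonneg_left ?_ (by positivity)
    calc ‖a * u * E₂ + a * v * E₁ + E₁ * E₂‖
        ≤ ‖a * u * E₂‖ + ‖a * v * E₁‖ + ‖E₁ * E₂‖ := norm_add₃_le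
      _ ≤ ‖a‖ * (17 / 2 * α) * ε + ‖a‖ * (17 / 2 * α) * ε + ε * ε := by
          rw [norm_mul, norm_mul, norm_mul, norm_mul, norm_mul]
          gcongr
  have hn2 : ‖a * u * v * E₀‖ ≤ ‖a‖ * (17 / 2 * α) * (17 / 2 * α) * ε := by
    rw [norm_mul, norm_mul, norm_mul]
    gcongr
  have hnum_le : ‖s * (a * u * E₂ + a * v * E₁ + E₁ * E₂) - a * u * v * E₀‖ ≤
      5 * α * (‖a‖ * (17 / 2 * α) * ε + ‖a‖ * (17 / 2 * α) * ε + ε * ε) +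
        ‖a‖ * (17 / 2 * α) * (17 / 2 * α) * ε :=
    (norm_sub_le _ _).trans (add_le_add hn1 hn2)
  refine hnum_le.trans ?_
  -- and compare with `14 ε |L₀| |s|`
  rw [hs]
  have hεε : ε * ε ≤ 5 / 2 * ‖a‖ * α * ε := mul_le_mul_of_nonneg_right hεa hε
  nlinarith [mul_nonneg (mul_nonneg ha.le hα.le) hε, hL₀, mul_le_mul_of_nonneg_left hL₀
    (show 0 ≤ 14 * ε * (5 * α) by positivity)]

/-- **`Z22:§8.u038`** [Z22 p.46, tex L2410], proof of Lemma 8.4: under (A), for `|s| = 5α` and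
any `j` (convention `β₄ = β₁, β₅ = β₂`),
`‖L(1+s+β_{j+1},χ)L(1+s+β_{j+2},χ)/L(1+s,χ) − L′(1,χ)(s+β_{j+1})(s+β_{j+2})/s‖ ≤ C𝓛⁻¹⁵`.
DISCHARGED from the tree's Lemma 5.8 (`lemma58_holds`, three times: at `1+s+β_{j+1}`, `1+s+β_{j+2}`,
`1+s`, all with `α ≤ |·−1| ≤ 10α`) and Lemma 5.7 (`lemma57_holds`: `L′(1,χ) ≫ D/φ(D) ≥ 1`, which
keeps `L(1+s,χ)` away from `0` on the circle). The manuscript writes "By Lemma 5.5 and 5.6".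
[cite: Zhang2022LandauSiegel, §8 Lemma 8.4 (proof), p.46] -/
theorem step8u038 (c' : ℝ) : ∃ C : ℝ, ForAllLarge fun D _ χ => AssumptionA D χ →
    ∀ j : ℕ, ∀ s : ℂ, ‖s‖ = 5 * alpha D →
      ‖χ.LFunction (1 + s + betaJ c' D (j + 1)) * χ.LFunction (1 + s + betaJ c' D (j + 2)) /
            χ.LFunction (1 + s) -
          deriv χ.LFunction 1 * ((s + betaJ c' D (j + 1)) * (s + betaJ c' D (j + 2)) / s)‖ ≤
        C * (ell D ^ 15)⁻¹ := by
  obtain ⟨C₅₈, D₅₈, h58⟩ := lemma58_holds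
  obtain ⟨c₀, hc₀, D₅₇, h57⟩ := lemma57_holds
  set C₁ : ℝ := max C₅₈ 0 with hC₁
  have hC₁0 : 0 ≤ C₁ := le_max_right _ _
  refine ⟨14 * C₁, max (max D₅₈ D₅₇) ⌈Real.exp (30 * π * |c'| + C₁ / (c₀ * π) + 3)⌉₊,
    fun D _ χ hD hq hp hA j s hs => ?_⟩
  have hD58 : D₅₈ ≤ D := le_trans (le_trans (le_max_left _ _) (le_max_left _ _)) hD
  have hD57 : D₅₇ ≤ D := le_trans (le_trans (le_max_right _ _) (le_max_left _ _)) hD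
  have hℓ' : 30 * π * |c'| + C₁ / (c₀ * π) + 3 ≤ ell D := le_ell (le_trans (le_max_right _ _) hD)
  have hq0 : 0 ≤ C₁ / (c₀ * π) := by positivity
  have hℓ'' : 30 * π * |c'| + 3 ≤ ell D := by linarith
  have hℓ3 : 3 ≤ ell D := by nlinarith [Real.pi_pos, abs_nonneg c']
  have hℓ0 : 0 < ell D := by linarith
  have hα0 : 0 < alpha D := alpha_pos' hℓ0
  have hsmall := small_shift_of_ell_ge hℓ''
  have hβ1 : ‖betaJ c' D (j + 1)‖ ≤ 7 / 2 * alpha D := norm_betaJ_le _ hα0.le hℓ0.le hsmall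
  have hβ2 : ‖betaJ c' D (j + 2)‖ ≤ 7 / 2 * alpha D := norm_betaJ_le _ hα0.le hℓ0.le hsmall
  -- `|L′(1,χ)| ≥ c₀`
  set a : ℂ := deriv χ.LFunction 1 with ha
  have h57' := h57 D χ hD57 hq hp hA
  have hDφ : (1 : ℝ) ≤ (D : ℝ) / Nat.totient D := by
    have hD1 : 0 < D := lt_of_lt_of_le (by norm_num) (three_le_of_ell hℓ3)
    have hφ : (0 : ℝ) < Nat.totient D := by exact_mod_cast Nat.totient_pos.mpr hD1
    rw [le_div_iff₀ hφ, one_mul]; exact_mod_cast Nat.totient_le D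
  have ha0 : c₀ ≤ ‖a‖ := by
    calc c₀ = c₀ * 1 := (mul_one _).symm
      _ ≤ c₀ * ((D : ℝ) / Nat.totient D) := mul_le_mul_of_nonneg_left hDφ hc₀.le
      _ ≤ a.re := h57'
      _ ≤ ‖a‖ := Complex.re_le_norm a
  have hapos : 0 < ‖a‖ := lt_of_lt_of_le hc₀ ha0
  -- Lemma 5.8 at the three points
  set ε : ℝ := C₁ * (ell D ^ 15)⁻¹ with hεdef
  have hε0 : 0 ≤ ε := by positivity
  have h58' : ∀ w : ℂ, alpha D ≤ ‖w‖ → ‖w‖ ≤ 10 * alpha D →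
      ‖χ.LFunction (1 + w) - a * w‖ ≤ ε := by
    intro w hw1 hw2
    have := h58 D χ hD58 hq hp hA (1 + w) (by simpa using hw1) (by simpa using hw2)
    rw [show (1 + w) - 1 = w by ring] at this
    exact this.trans (mul_le_mul_of_nonneg_right (le_max_left _ _) (by positivity))
  have hu : ‖s + betaJ c' D (j + 1)‖ ≤ 17 / 2 * alpha D := by
    have := norm_add_le s (betaJ c' D (j + 1)); linarith
  have hv : ‖s + betaJ c' D (j + 2)‖ ≤ 17 / 2 * alpha D := by
    have := norm_add_le s (betaJ c' D (j + 2)); linarith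
  have hu' : alpha D ≤ ‖s + betaJ c' D (j + 1)‖ := by
    have := norm_sub_norm_le s (-betaJ c' D (j + 1))
    rw [sub_neg_eq_add, norm_neg] at this; linarith
  have hv' : alpha D ≤ ‖s + betaJ c' D (j + 2)‖ := by
    have := norm_sub_norm_le s (-betaJ c' D (j + 2))
    rw [sub_neg_eq_add, norm_neg] at this; linarith
  have e1 := h58' _ hu' (by linarith)
  have e2 := h58' _ hv' (by linarith)
  have e0 := h58' s (by linarith) (by linarith)
  -- `ε ≤ (5/2)|a|α`: from `𝓛 ≥ C₁/(c₀π)`, `𝓛⁶ ≥ 𝓛`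
  have hεa : ε ≤ 5 / 2 * ‖a‖ * alpha D := by
    rw [hεdef, Section2.alpha_eq_pi_div_ell9]
    have hℓ1 : 1 ≤ ell D := by linarith
    have hℓ6 : ell D ≤ ell D ^ 6 := by
      calc ell D = ell D ^ 1 := (pow_one _).symm
        _ ≤ ell D ^ 6 := pow_le_pow_right₀ hℓ1 (by norm_num)
    have hℓq : C₁ / (c₀ * π) ≤ ell D := by
      have : 0 ≤ 30 * π * |c'| := by positivity
      linarith
    have hC₁le : C₁ ≤ c₀ * π * ell D ^ 6 := by
      rw [div_le_iff₀ (by positivity)] at hℓq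
      nlinarith [mul_pos hc₀ Real.pi_pos]
    have h15 : (ell D ^ 15)⁻¹ = (ell D ^ 6)⁻¹ * (ell D ^ 9)⁻¹ := by
      rw [← mul_inv, ← pow_add]
    rw [h15]
    have h9 : 0 < ell D ^ 9 := by positivity
    have h6 : 0 < ell D ^ 6 := by positivity
    calc C₁ * ((ell D ^ 6)⁻¹ * (ell D ^ 9)⁻¹)
        ≤ (c₀ * π * ell D ^ 6) * ((ell D ^ 6)⁻¹ * (ell D ^ 9)⁻¹) :=
          mul_le_mul_of_nonneg_right hC₁le (by positivity)
      _ = c₀ * (π / ell D ^ 9) := by field_simp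
      _ ≤ ‖a‖ * (π / ell D ^ 9) := mul_le_mul_of_nonneg_right ha0 (by positivity)
      _ ≤ 5 / 2 * ‖a‖ * (π / ell D ^ 9) := by nlinarith [div_pos Real.pi_pos h9]
  have e1' : ‖χ.LFunction (1 + s + betaJ c' D (j + 1)) - a * (s + betaJ c' D (j + 1))‖ ≤ ε := by
    rw [show (1 : ℂ) + s + betaJ c' D (j + 1) = 1 + (s + betaJ c' D (j + 1)) by ring]; exact e1
  have e2' : ‖χ.LFunction (1 + s + betaJ c' D (j + 2)) - a * (s + betaJ c' D (j + 2))‖ ≤ ε := by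
    rw [show (1 : ℂ) + s + betaJ c' D (j + 2) = 1 + (s + betaJ c' D (j + 2)) by ring]; exact e2
  have key := norm_ratio_sub_le hα0 hε0 hapos hs hu hv e1' e2' e0 hεa
  rw [show a * ((s + betaJ c' D (j + 1)) * (s + betaJ c' D (j + 2)) / s) =
      a * (s + betaJ c' D (j + 1)) * (s + betaJ c' D (j + 2)) / s by ring]
  calc _ ≤ 14 * ε := key
    _ = 14 * C₁ * (ell D ^ 15)⁻¹ := by rw [hεdef]; ring

/-! ### Bridges to the typed nodes of record (`TypedSection08B`, L2-t6) -/

/-- **`Z22:§8.u027` of record DISCHARGED**: L2-t6's `Typed.S8B.Sum82EqLineIntegral c′` holds (for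
every `c′`), by `Section8PerronSteps.step8u027` (valid for every modulus and every `x > 0`).
[cite: Zhang2022LandauSiegel, §8 proof of Lemma 8.2 p.45] -/
theorem sum82EqLineIntegral_holds (c' : ℝ) : Typed.S8B.Sum82EqLineIntegral c' := by
  intro D _ χ j _ μ _ x hTx _
  have hx : 0 < x := (Real.exp_pos _).trans hTx
  unfold Typed.S8B.sum82 Typed.S8B.vlineInt
  exact Section8PerronSteps.step8u027 c' χ j μ hx

variable (c' : ℝ) in
/-- `Sum82EqLineIntegral` — `_holds` alias of `sum82EqLineIntegral_holds` above under the fact's exact name, stated under the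
prover's own binders as section variables (appended 2026-08-28, D-0026 bookkeeping: the proof term is the
existing theorem of this file; no statement, definition or attribute is edited; no new named fact; the
ledger's debt table listed the fact unproved). [cite: Zhang2022LandauSiegel, §8 proof of Lemma 8.2 p.45] -/
theorem _root_.Literature.NumberTheory.LFunctions.Zhang2022.Typed.S8B.Sum82EqLineIntegral_holds :
    _root_.Literature.NumberTheory.LFunctions.Zhang2022.Typed.S8B.Sum82EqLineIntegral c' :=
  _root_.Literature.NumberTheory.LFunctions.Zhang2022.Section8Lemma84Steps.sum82EqLineIntegral_holds (c' := c')

/-- **`Z22:§8.u038` of record DISCHARGED**: L2-t6's `Typed.S8B.LQuotientOnCircle c′` holds (for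
every `c′`), by `step8u038`. [cite: Zhang2022LandauSiegel, §8 proof of Lemma 8.4 p.46] -/
theorem lQuotientOnCircle_holds (c' : ℝ) : Typed.S8B.LQuotientOnCircle c' := by
  obtain ⟨C, D₀, h⟩ := step8u038 c'
  exact ⟨C, D₀, fun D _ χ hD hq hp hA j _ s hs => h D χ hD hq hp hA j s hs⟩

variable (c' : ℝ) in
/-- `LQuotientOnCircle` — `_holds` alias of `lQuotientOnCircle_holds` above under the fact's exact name, stated under the
prover's own binders as section variables (appended 2026-08-28, D-0026 bookkeeping: the proof term is the
existing theorem of this file; no statement, definition or attribute is edited; no new named fact; the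
ledger's debt table listed the fact unproved). [cite: Zhang2022LandauSiegel, §8 proof of Lemma 8.4 p.46] -/
theorem _root_.Literature.NumberTheory.LFunctions.Zhang2022.Typed.S8B.LQuotientOnCircle_holds :
    _root_.Literature.NumberTheory.LFunctions.Zhang2022.Typed.S8B.LQuotientOnCircle c' :=
  _root_.Literature.NumberTheory.LFunctions.Zhang2022.Section8Lemma84Steps.lQuotientOnCircle_holds (c' := c')

/-- **`Z22:§8.u030` of record, first line ⇒ second line**: L2-t6's `Typed.S8B.Sum82ViaCircle c′`
implies `Typed.S8B.Sum82CircleMainTerm c′` (`Section8Lemma82Steps.sum82CircleMainTerm_of_viaCircle`).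
[cite: Zhang2022LandauSiegel, §8 proof of Lemma 8.2 pp.45–46] -/
theorem sum82CircleMainTerm_of_viaCircle (c' : ℝ) (h : Typed.S8B.Sum82ViaCircle c') :
    Typed.S8B.Sum82CircleMainTerm c' := by
  unfold Typed.S8B.Sum82ViaCircle at h
  unfold Typed.S8B.Sum82CircleMainTerm
  simp only [Typed.S8B.sum82, Typed.S8B.circInt] at h ⊢
  exact Section8Lemma82Steps.sum82CircleMainTerm_of_viaCircle c' h

/-- **`Z22:Lem8.2.pf` reduced to its contour shift**: Lemma 8.2 (`Skeleton.Lemma82 c′`) follows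
from the first line of `u030` alone (L2-t6's `Typed.S8B.Sum82ViaCircle c′`, the printed "It follows
by Lemma 5.6 that … `= (1/2πi)∮_{|s|=5α} … + O(ε₁)`"), via `sum82CircleMainTerm_of_viaCircle` and
L2-t6's `lemma82_of_circleMainTerm`. [cite: Zhang2022LandauSiegel, §8 proof of Lemma 8.2 pp.45–46] -/
theorem lemma82_of_viaCircle (c' : ℝ) (h : Typed.S8B.Sum82ViaCircle c') : Lemma82 c' :=
  Typed.S8B.lemma82_of_circleMainTerm c' (sum82CircleMainTerm_of_viaCircle c' h)

end Literature.NumberTheory.LFunctions.Zhang2022.Section8Lemma84Steps
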